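/-
Copyright (c) 2026 the pub-hodgecm-mathlib formalisation cell (harness21).  Prover seat hodgecm-mathlib-A-p19 (g28): road «S3-ram» (LEAD F0P3a-plan (g13); (Cnt2′) chair
F0P3a-p07 (g14) ruling (9)(b)), organ (z6) «FIX-FINITE, BLOCK LITERAL» for the type-(2) junction of F0P2-p02 (g14) — part 1, the three engines; 2026-09-02.
-/
import Literature.NumberTheory.Automorphic.UnitaryLatticeTreeAxisEndoFrame               -- ★ `coe_endoGL_eq_endoShape`, `det_endoShape`; brings ★ `UnitaryLatticeTreeDefs` (`pairing`, `dualLatt`, `IsIntMatrix`), ★ `endoGL`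
import HarnessLib

/-!
# Lattices stable under a block literal `ι(a, u)`: coercivity of the anisotropic binary form `det[b, a·b]`, the Gram determinant of two plane vectors, and the
# Cayley–Hamilton projections with the denominator `χ_a(u)` kept (Kottwitz 1986 §3; Weil, *Basic Number Theory* II §1; Jacobowitz 1962 §4)

Topic `NumberTheory/Automorphic`; namespace `Literature.NumberTheory.Automorphic.UnitaryLatticeTree`.  THEOREMS ONLY (no definition, no instance, no notation, no named fact,
no `sorry`); kernel lane `--supports stmt-HodgeConjecture-24833`; datum-free (`K` with `Valued K ℤᵐ⁰`).  Cell `pub/hodgecm-mathlib` (D-0151), crux H413; road «S3-ram», (Cnt2′)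
route B «TYPE-(2) JUNCTION» (chair F0P3a-p07 (g14) rulings (8)–(9)), organ **(z6) «FIX-FINITE, BLOCK LITERAL»**: part 2 (★ `UnitaryLatticeTreeBlockFixedBounded`) turns these three
engines into the interval `ϖδL₀ ≤ M ≤ δ⁻¹L₀` for every vertex fixed by an ELLIPTIC block literal and into the `hFfin` binder of F0P2-p02 (g14)'s `strataCount_J₀_block`.
HONEST LABEL: HC_CM is proved only modulo the 2 remaining named inputs (hLiu418 24832, h413 24833) until rung 0 closes; nothing printed is asserted here (elementary algebra).

THE MATHEMATICS (form `H = ι-shape(H₂, h) = !![H₂₀₀, 0, H₂₀₁; 0, h, 0; H₂₁₀, 0, H₂₁₁]`, element `T = ι(a, u) = !![a₀₀, 0, a₀₁; 0, u, 0; a₁₀, 0, a₁₁]`, `Δ := χ_a(u) = u² − tr(a)u + det a`).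
* §1 COERCIVITY of an anisotropic integral binary form over a valued field whose principal units are squares: `|X² − DY²| = max(|X|², |D||Y|²)` for `D` a non-square
  (`v_mul_self_sub_mul_eq_max`), hence — completing the square, `4aQ = (2ax + by)² − Dy²` — **`|4a²D|·|x|² ≤ |Q(x,y)|` and `|4a²D|·|y|² ≤ |Q(x,y)|`** for `Q = ax² + bxy + cy²`
  integral with `D = b² − 4ac` a non-square and `|2| = 1` (`v_mul_sq_le_v_binaryForm`; explicit constant, no compactness).
* §2 the GRAM DETERMINANT of two `W`-vectors (`W = ⟨e₀, e₂⟩`, `b₁ = b′₁ = 0`): `⟨b,b⟩⟨b′,b′⟩ − ⟨b,b′⟩⟨b′,b⟩ = σ(det[b,b′])·det[b,b′]·det H₂`, so INTEGRAL pairings and `|det H₂| = 1` force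
  `|det[b,b′]| ≤ 1` (`v_det_le_one_of_pairing_le_one`).
* §3 CAYLEY–HAMILTON with the denominator kept: `T x = (a(x₀,x₂), u x₁)` (`endoShape_mulVec_eq`), `T²x − tr(a)·Tx + det(a)·x = Δ·x₁e₁` (`endoShape_cayleyHamilton_apply`), so a
  `T`-stable `𝒪`-lattice `M ∋ x` (with `a`, `u` integral) contains `Δx₁e₁` and `Δx_W = (Δx₀, 0, Δx₂)` (`smul_line_mem_and_smul_plane_mem_of_map_endoShape_le`).

## References
* [Kottwitz1986] R. E. Kottwitz, *Base change for unit elements of Hecke algebras*, Compositio Math. 60 (1986), §3.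
* [WeilBNT1967] A. Weil, *Basic Number Theory* (1967), Ch. II §1 Prop. 1 (anisotropic forms over local fields are coercive).
* [Jacobowitz1962] R. Jacobowitz, *Hermitian forms over local fields*, Amer. J. Math. 84 (1962), §4 (Gram determinants).
* [Serre1980Trees] J.-P. Serre, *Trees* (1980), Ch. II §1.1.
* [Rogawski1990] J. D. Rogawski, *Automorphic Representations of Unitary Groups in Three Variables*, Ann. of Math. Stud. 123 (1990), §4.8 Case (a) p. 53 (the pattern `ι`).
-/

set_option autoImplicit false

noncomputable section

open scoped Valued WithZero Matrix MatrixGroups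

namespace Literature.NumberTheory.Automorphic.UnitaryLatticeTree

open Literature.NumberTheory.Automorphic Literature.NumberTheory.Automorphic.HermitianLattice Literature.NumberTheory.Rogawski1990

variable {K : Type*} [Field K] [Valued K ℤᵐ⁰]

/-! ## §1 Coercivity of an anisotropic integral binary quadratic form -/

/-- **`|X² − D·Y²| = max(|X|², |D|·|Y|²)` for `D` a non-square**, in a valued field whose principal units are squares: equal valuations cannot cancel, since then
`D·Y²∕X² ≡ 1` would be a square. [cite: WeilBNT1967, Ch. II §1 Prop. 1] -/
theorem v_mul_self_sub_mul_eq_max (hsq : ∀ u : K, Valued.v (u - 1) < 1 → IsSquare u) {D : K} (hD : ¬ IsSquare D) (X y : K) :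
    Valued.v (X * X - D * (y * y)) = max (Valued.v (X * X)) (Valued.v (D * (y * y))) := by
  by_cases hne : Valued.v (X * X) = Valued.v (D * (y * y))
  swap
  · rw [sub_eq_add_neg, Valuation.map_add_of_distinct_val _ (by rwa [Valuation.map_neg]), Valuation.map_neg]
  -- equal valuations: no cancellation
  have hD0 : D ≠ 0 := fun h0 => hD ⟨0, by rw [h0, mul_zero]⟩
  by_cases hy : y = 0
  · subst hy
    have hX : X = 0 := by simpa using hne
    subst hX
    simp
  have hX0 : X * X ≠ 0 := by
    intro h0
    rw [h0, map_zero, eq_comm, Valuation.zero_iff] at hne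
    exact mul_ne_zero hD0 (mul_ne_zero hy hy) hne
  refine le_antisymm (Valuation.map_sub _ _ _) ?_
  rw [← hne, max_self]
  by_contra hle
  have hlt := not_le.1 hle
  -- `u := D y² ∕ X²` is a principal unit, hence a square, hence `D` is a square
  apply hD
  have hu1 : Valued.v (D * (y * y) / (X * X) - 1) < 1 := by
    rw [div_sub_one hX0, map_div₀, div_lt_one₀ ((Valuation.pos_iff _).2 hX0), Valuation.map_sub_swap]
    exact hlt
  obtain ⟨r, hr⟩ := hsq _ hu1
  refine ⟨r * X / y, ?_⟩
  have hy2 : y * y ≠ 0 := mul_ne_zero hy hy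
  have hr' : D * (y * y) = r * r * (X * X) := by rw [← div_mul_cancel₀ (D * (y * y)) hX0, hr]
  field_simp
  linear_combination hr'

/-- **COERCIVITY OF AN ANISOTROPIC INTEGRAL BINARY FORM**: for `Q(x,y) = ax² + bxy + cy²` with `|a|, |b|, |c| ≤ 1` and `D = b² − 4ac` a NON-SQUARE (`|2| = 1`, principal units
squares): `|4a²D|·|x|² ≤ |Q(x,y)|` and `|4a²D|·|y|² ≤ |Q(x,y)|` (complete the square: `4aQ = (2ax + by)² − Dy²`, and `v_mul_self_sub_mul_eq_max`). [cite: WeilBNT1967, Ch. II §1 Prop. 1] -/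
theorem v_mul_sq_le_v_binaryForm (h2 : Valued.v (2 : K) = 1) (hsq : ∀ u : K, Valued.v (u - 1) < 1 → IsSquare u) {a b c : K} (ha : Valued.v a ≤ 1) (hb : Valued.v b ≤ 1)
    (hc : Valued.v c ≤ 1) (hD : ¬ IsSquare (b * b - 4 * a * c)) (x y : K) :
    Valued.v (4 * (a * a) * (b * b - 4 * a * c)) * (Valued.v x * Valued.v x) ≤ Valued.v (a * (x * x) + b * (x * y) + c * (y * y)) ∧
      Valued.v (4 * (a * a) * (b * b - 4 * a * c)) * (Valued.v y * Valued.v y) ≤ Valued.v (a * (x * x) + b * (x * y) + c * (y * y)) := by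
  have h4 : Valued.v (4 : K) = 1 := by rw [show (4 : K) = 2 * 2 by norm_num, map_mul, h2, one_mul]
  have hDv : Valued.v (b * b - 4 * a * c) ≤ 1 := by
    refine (Valuation.map_sub _ _ _).trans (max_le ?_ ?_)
    · rw [map_mul]; exact mul_le_one' hb hb
    · rw [map_mul, map_mul, h4, one_mul]; exact mul_le_one' ha hc
  obtain ⟨Q, hQ⟩ : ∃ Q : K, Q = a * (x * x) + b * (x * y) + c * (y * y) := ⟨_, rfl⟩
  rw [← hQ]
  have hid : 4 * a * Q = (2 * a * x + b * y) * (2 * a * x + b * y) - (b * b - 4 * a * c) * (y * y) := by rw [hQ]; ring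
  have hmax := v_mul_self_sub_mul_eq_max hsq hD (2 * a * x + b * y) y
  rw [← hid] at hmax
  have h4aQ : Valued.v (4 * a * Q) ≤ Valued.v Q := by
    rw [map_mul, map_mul, h4, one_mul]; exact mul_le_of_le_one_left' ha
  have hyD : Valued.v (b * b - 4 * a * c) * (Valued.v y * Valued.v y) ≤ Valued.v Q := by
    have h := (le_max_right _ _).trans (hmax.symm.le.trans h4aQ)
    rwa [map_mul, map_mul] at h
  have hXX : Valued.v (2 * a * x + b * y) * Valued.v (2 * a * x + b * y) ≤ Valued.v Q := by
    have h := (le_max_left _ _).trans (hmax.symm.le.trans h4aQ)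
    rwa [map_mul] at h
  have haa : Valued.v a * Valued.v a ≤ 1 := mul_le_one' ha ha
  have hc₀ : Valued.v (4 * (a * a) * (b * b - 4 * a * c)) = Valued.v a * Valued.v a * Valued.v (b * b - 4 * a * c) := by
    rw [map_mul, map_mul, map_mul, h4, one_mul]
  rw [hc₀]
  refine ⟨?_, ?_⟩
  swap
  · calc Valued.v a * Valued.v a * Valued.v (b * b - 4 * a * c) * (Valued.v y * Valued.v y)
        = (Valued.v a * Valued.v a) * (Valued.v (b * b - 4 * a * c) * (Valued.v y * Valued.v y)) := by ac_rfl
      _ ≤ Valued.v (b * b - 4 * a * c) * (Valued.v y * Valued.v y) := mul_le_of_le_one_left' haa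
      _ ≤ Valued.v Q := hyD
  · have h2ax : Valued.v a * Valued.v x ≤ max (Valued.v (2 * a * x + b * y)) (Valued.v (b * y)) := by
      have h := Valuation.map_sub Valued.v (2 * a * x + b * y) (b * y)
      rw [show 2 * a * x + b * y - b * y = 2 * a * x by ring, map_mul, map_mul, h2, one_mul] at h
      exact h
    rcases le_total (Valued.v (b * y)) (Valued.v (2 * a * x + b * y)) with hle | hle
    · rw [max_eq_left hle] at h2ax
      calc Valued.v a * Valued.v a * Valued.v (b * b - 4 * a * c) * (Valued.v x * Valued.v x)
          = Valued.v (b * b - 4 * a * c) * ((Valued.v a * Valued.v x) * (Valued.v a * Valued.v x)) := by ac_rfl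
        _ ≤ (Valued.v a * Valued.v x) * (Valued.v a * Valued.v x) := mul_le_of_le_one_left' hDv
        _ ≤ Valued.v (2 * a * x + b * y) * Valued.v (2 * a * x + b * y) := mul_le_mul' h2ax h2ax
        _ ≤ Valued.v Q := hXX
    · rw [max_eq_right hle] at h2ax
      have hay : Valued.v a * Valued.v x ≤ Valued.v y := h2ax.trans (by rw [map_mul]; exact mul_le_of_le_one_left' hb)
      calc Valued.v a * Valued.v a * Valued.v (b * b - 4 * a * c) * (Valued.v x * Valued.v x)
          = Valued.v (b * b - 4 * a * c) * ((Valued.v a * Valued.v x) * (Valued.v a * Valued.v x)) := by ac_rfl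
        _ ≤ Valued.v (b * b - 4 * a * c) * (Valued.v y * Valued.v y) := mul_le_mul' le_rfl (mul_le_mul' hay hay)
        _ ≤ Valued.v Q := hyD

/-! ## §2 The Gram determinant of two `W`-vectors -/

omit [Valued K ℤᵐ⁰] in
/-- **Gram determinant identity** on `W = ⟨e₀, e₂⟩` for the `ι`-shaped form: `⟨b,b⟩⟨b′,b′⟩ − ⟨b,b′⟩⟨b′,b⟩ = σ(det[b,b′])·det[b,b′]·det H₂` (`b₁ = b′₁ = 0`). [cite: Jacobowitz1962, §4] -/
theorem pairing_mul_pairing_sub_eq_of_apply_one_eq_zero (σ : K →+* K) (H₂ : Matrix (Fin 2) (Fin 2) K) (h : K) {b b' : Fin 3 → K} (hb : b 1 = 0) (hb' : b' 1 = 0) :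
    pairing σ (!![H₂ 0 0, 0, H₂ 0 1; 0, h, 0; H₂ 1 0, 0, H₂ 1 1] : Matrix (Fin 3) (Fin 3) K) b b *
        pairing σ (!![H₂ 0 0, 0, H₂ 0 1; 0, h, 0; H₂ 1 0, 0, H₂ 1 1] : Matrix (Fin 3) (Fin 3) K) b' b' -
      pairing σ (!![H₂ 0 0, 0, H₂ 0 1; 0, h, 0; H₂ 1 0, 0, H₂ 1 1] : Matrix (Fin 3) (Fin 3) K) b b' *
        pairing σ (!![H₂ 0 0, 0, H₂ 0 1; 0, h, 0; H₂ 1 0, 0, H₂ 1 1] : Matrix (Fin 3) (Fin 3) K) b' b =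
      σ (b 0 * b' 2 - b 2 * b' 0) * (b 0 * b' 2 - b 2 * b' 0) * (H₂ 0 0 * H₂ 1 1 - H₂ 0 1 * H₂ 1 0) := by
  simp only [pairing_apply, Fin.sum_univ_three, hb, hb', map_zero, map_sub, map_mul]
  simp
  ring

/-- **Integral pairings force `|det[b, b′]| ≤ 1`** for two `W`-vectors when `|det H₂| = 1`. [cite: Jacobowitz1962, §4] [cite: Kottwitz1986, §3] -/
theorem v_det_le_one_of_pairing_le_one {σ : K →+* K} (hvσ : ∀ a, Valued.v (σ a) = Valued.v a) {H₂ : Matrix (Fin 2) (Fin 2) K} (hH₂d : Valued.v H₂.det = 1) (h : K)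
    {b b' : Fin 3 → K} (hb : b 1 = 0) (hb' : b' 1 = 0)
    (h00 : Valued.v (pairing σ (!![H₂ 0 0, 0, H₂ 0 1; 0, h, 0; H₂ 1 0, 0, H₂ 1 1] : Matrix (Fin 3) (Fin 3) K) b b) ≤ 1)
    (h11 : Valued.v (pairing σ (!![H₂ 0 0, 0, H₂ 0 1; 0, h, 0; H₂ 1 0, 0, H₂ 1 1] : Matrix (Fin 3) (Fin 3) K) b' b') ≤ 1)
    (h01 : Valued.v (pairing σ (!![H₂ 0 0, 0, H₂ 0 1; 0, h, 0; H₂ 1 0, 0, H₂ 1 1] : Matrix (Fin 3) (Fin 3) K) b b') ≤ 1)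
    (h10 : Valued.v (pairing σ (!![H₂ 0 0, 0, H₂ 0 1; 0, h, 0; H₂ 1 0, 0, H₂ 1 1] : Matrix (Fin 3) (Fin 3) K) b' b) ≤ 1) :
    Valued.v (b 0 * b' 2 - b 2 * b' 0) ≤ 1 := by
  have hid := pairing_mul_pairing_sub_eq_of_apply_one_eq_zero σ H₂ h hb hb'
  have hdet : H₂ 0 0 * H₂ 1 1 - H₂ 0 1 * H₂ 1 0 = H₂.det := (Matrix.det_fin_two H₂).symm
  rw [hdet] at hid
  have hle : Valued.v (σ (b 0 * b' 2 - b 2 * b' 0) * (b 0 * b' 2 - b 2 * b' 0) * H₂.det) ≤ 1 := by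
    rw [← hid]
    refine (Valuation.map_sub _ _ _).trans (max_le ?_ ?_)
    · rw [map_mul]; exact mul_le_one' h00 h11
    · rw [map_mul]; exact mul_le_one' h01 h10
  rw [map_mul, map_mul, hvσ, hH₂d, mul_one] at hle
  by_contra hne
  exact absurd hle (not_le.2 (lt_of_lt_of_le (not_le.1 hne) (le_mul_of_one_le_right' (not_le.1 hne).le)))

/-! ## §3 Cayley–Hamilton with the denominator kept: the two projections of a `T`-stable lattice -/

omit [Valued K ℤᵐ⁰] in
/-- The `ι`-shaped `T = ι(a, u)` acts by `a` on `W = ⟨e₀, e₂⟩` and by `u` on `e₁`. [cite: Rogawski1990, §4.8 Case (a) p. 53] -/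
theorem endoShape_mulVec_eq (a : Matrix (Fin 2) (Fin 2) K) (u : K) (x : Fin 3 → K) :
    (!![a 0 0, 0, a 0 1; 0, u, 0; a 1 0, 0, a 1 1] : Matrix (Fin 3) (Fin 3) K) *ᵥ x = ![a 0 0 * x 0 + a 0 1 * x 2, u * x 1, a 1 0 * x 0 + a 1 1 * x 2] := by
  funext i
  fin_cases i <;> simp [Matrix.mulVec, dotProduct, Fin.sum_univ_three]

omit [Valued K ℤᵐ⁰] in
/-- `T²x − tr(a)·Tx + det(a)·x = χ_a(u)·x₁e₁` for the `ι`-shaped `T = ι(a, u)` (Cayley–Hamilton for `a` on `W`, the scalar `u` on the line), on explicit vectors.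
[cite: Kottwitz1986, §3] -/
theorem endoShape_cayleyHamilton_apply (a : Matrix (Fin 2) (Fin 2) K) (u : K) (x : Fin 3 → K) :
    (![a 0 0 * (a 0 0 * x 0 + a 0 1 * x 2) + a 0 1 * (a 1 0 * x 0 + a 1 1 * x 2), u * (u * x 1), a 1 0 * (a 0 0 * x 0 + a 0 1 * x 2) + a 1 1 * (a 1 0 * x 0 + a 1 1 * x 2)] : Fin 3 → K) -
        (a 0 0 + a 1 1) • (![a 0 0 * x 0 + a 0 1 * x 2, u * x 1, a 1 0 * x 0 + a 1 1 * x 2] : Fin 3 → K) + (a 0 0 * a 1 1 - a 0 1 * a 1 0) • x =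
      ![0, (u * u - (a 0 0 + a 1 1) * u + (a 0 0 * a 1 1 - a 0 1 * a 1 0)) * x 1, 0] := by
  funext i
  fin_cases i <;> simp <;> ring

/-- **The line and plane parts of a `T`-stable lattice, with denominator `Δ = χ_a(u)`**: if `M` is an `𝒪`-lattice stable under the integral `ι`-shaped `T = ι(a, u)` and `x ∈ M`,
then `Δ·x₁e₁ ∈ M` and `Δ·x_W = (Δx₀, 0, Δx₂) ∈ M`. [cite: Kottwitz1986, §3] -/
theorem smul_line_mem_and_smul_plane_mem_of_map_endoShape_le {a : Matrix (Fin 2) (Fin 2) K} (ha : IsIntMatrix a) {u : K} (hu : Valued.v u ≤ 1)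
    {M : Submodule 𝒪[K] (Fin 3 → K)}
    (hTM : M.map ((Matrix.toLin' (!![a 0 0, 0, a 0 1; 0, u, 0; a 1 0, 0, a 1 1] : Matrix (Fin 3) (Fin 3) K)).restrictScalars 𝒪[K]) ≤ M)
    {x : Fin 3 → K} (hx : x ∈ M) :
    (![0, (u * u - (a 0 0 + a 1 1) * u + (a 0 0 * a 1 1 - a 0 1 * a 1 0)) * x 1, 0] : Fin 3 → K) ∈ M ∧
      (![(u * u - (a 0 0 + a 1 1) * u + (a 0 0 * a 1 1 - a 0 1 * a 1 0)) * x 0, 0,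
          (u * u - (a 0 0 + a 1 1) * u + (a 0 0 * a 1 1 - a 0 1 * a 1 0)) * x 2] : Fin 3 → K) ∈ M := by
  have hT : ∀ y ∈ M, (!![a 0 0, 0, a 0 1; 0, u, 0; a 1 0, 0, a 1 1] : Matrix (Fin 3) (Fin 3) K) *ᵥ y ∈ M := fun y hy => by
    have h := hTM (Submodule.mem_map.2 ⟨y, hy, rfl⟩)
    rw [LinearMap.restrictScalars_apply, Matrix.toLin'_apply] at h
    exact h
  have htr : Valued.v (a 0 0 + a 1 1) ≤ 1 := (Valuation.map_add _ _ _).trans (max_le (ha 0 0) (ha 1 1))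
  have hdet : Valued.v (a 0 0 * a 1 1 - a 0 1 * a 1 0) ≤ 1 := by
    refine (Valuation.map_sub _ _ _).trans (max_le ?_ ?_)
    · rw [map_mul]; exact mul_le_one' (ha 0 0) (ha 1 1)
    · rw [map_mul]; exact mul_le_one' (ha 0 1) (ha 1 0)
  have hΔ : Valued.v (u * u - (a 0 0 + a 1 1) * u + (a 0 0 * a 1 1 - a 0 1 * a 1 0)) ≤ 1 := by
    refine (Valuation.map_add _ _ _).trans (max_le ((Valuation.map_sub _ _ _).trans (max_le ?_ ?_)) hdet)
    · rw [map_mul]; exact mul_le_one' hu hu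
    · rw [map_mul]; exact mul_le_one' htr hu
  -- the line part: the Cayley–Hamilton combination lies in `M`
  have hTx : (![a 0 0 * x 0 + a 0 1 * x 2, u * x 1, a 1 0 * x 0 + a 1 1 * x 2] : Fin 3 → K) ∈ M := by
    rw [← endoShape_mulVec_eq a u x]; exact hT x hx
  have hTTx : (![a 0 0 * (a 0 0 * x 0 + a 0 1 * x 2) + a 0 1 * (a 1 0 * x 0 + a 1 1 * x 2), u * (u * x 1),
      a 1 0 * (a 0 0 * x 0 + a 0 1 * x 2) + a 1 1 * (a 1 0 * x 0 + a 1 1 * x 2)] : Fin 3 → K) ∈ M := by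
    have h := hT _ hTx
    rw [endoShape_mulVec_eq a u] at h
    have e : (![a 0 0 * (a 0 0 * x 0 + a 0 1 * x 2) + a 0 1 * (a 1 0 * x 0 + a 1 1 * x 2), u * (u * x 1),
        a 1 0 * (a 0 0 * x 0 + a 0 1 * x 2) + a 1 1 * (a 1 0 * x 0 + a 1 1 * x 2)] : Fin 3 → K) =
        ![a 0 0 * (![a 0 0 * x 0 + a 0 1 * x 2, u * x 1, a 1 0 * x 0 + a 1 1 * x 2] : Fin 3 → K) 0 + a 0 1 * (![a 0 0 * x 0 + a 0 1 * x 2, u * x 1, a 1 0 * x 0 + a 1 1 * x 2] : Fin 3 → K) 2,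
          u * (![a 0 0 * x 0 + a 0 1 * x 2, u * x 1, a 1 0 * x 0 + a 1 1 * x 2] : Fin 3 → K) 1,
          a 1 0 * (![a 0 0 * x 0 + a 0 1 * x 2, u * x 1, a 1 0 * x 0 + a 1 1 * x 2] : Fin 3 → K) 0 + a 1 1 * (![a 0 0 * x 0 + a 0 1 * x 2, u * x 1, a 1 0 * x 0 + a 1 1 * x 2] : Fin 3 → K) 2] := by
      simp
    rw [e]; exact h
  have hline : (![0, (u * u - (a 0 0 + a 1 1) * u + (a 0 0 * a 1 1 - a 0 1 * a 1 0)) * x 1, 0] : Fin 3 → K) ∈ M := by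
    rw [← endoShape_cayleyHamilton_apply a u x]
    have h1 : (a 0 0 + a 1 1) • (![a 0 0 * x 0 + a 0 1 * x 2, u * x 1, a 1 0 * x 0 + a 1 1 * x 2] : Fin 3 → K) =
        (⟨a 0 0 + a 1 1, htr⟩ : 𝒪[K]) • (![a 0 0 * x 0 + a 0 1 * x 2, u * x 1, a 1 0 * x 0 + a 1 1 * x 2] : Fin 3 → K) := rfl
    have h2 : (a 0 0 * a 1 1 - a 0 1 * a 1 0) • x = (⟨a 0 0 * a 1 1 - a 0 1 * a 1 0, hdet⟩ : 𝒪[K]) • x := rfl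
    rw [h1, h2]
    exact M.add_mem (M.sub_mem hTTx (M.smul_mem _ hTx)) (M.smul_mem _ hx)
  refine ⟨hline, ?_⟩
  -- the plane part: `Δ·x − Δ·x₁e₁`
  have h3 : (![(u * u - (a 0 0 + a 1 1) * u + (a 0 0 * a 1 1 - a 0 1 * a 1 0)) * x 0, 0,
      (u * u - (a 0 0 + a 1 1) * u + (a 0 0 * a 1 1 - a 0 1 * a 1 0)) * x 2] : Fin 3 → K) =
      (u * u - (a 0 0 + a 1 1) * u + (a 0 0 * a 1 1 - a 0 1 * a 1 0)) • x -
        (![0, (u * u - (a 0 0 + a 1 1) * u + (a 0 0 * a 1 1 - a 0 1 * a 1 0)) * x 1, 0] : Fin 3 → K) := by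
    funext i
    fin_cases i <;> simp
  have h4 : (u * u - (a 0 0 + a 1 1) * u + (a 0 0 * a 1 1 - a 0 1 * a 1 0)) • x =
      (⟨u * u - (a 0 0 + a 1 1) * u + (a 0 0 * a 1 1 - a 0 1 * a 1 0), hΔ⟩ : 𝒪[K]) • x := rfl
  rw [h3, h4]
  exact M.sub_mem (M.smul_mem _ hx) hline

end Literature.NumberTheory.Automorphic.UnitaryLatticeTree

end
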